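import Summits.MatrixMultiplication.MatrixMultiplication.Theses.CondensationDistance
import Summits.MatrixMultiplication.MatrixMultiplication.Theorems.CondensationDistanceDerivationsBoundOmegaStubPairsSimulation
import Summits.MatrixMultiplication.MatrixMultiplication.Theorems.CondensationDistanceDerivationsBoundOmegaStubAndrewsLeadingBlock
import Summits.MatrixMultiplication.MatrixMultiplication.Theorems.CondensationDistanceDerivationsBoundOmegaStubBorderRankExponent

/-!
# Crux `DerivationsBoundOmega` of route CondensationDistance (stmt-MatrixMultiplication-15940) — proof

The LITERATURE BRIDGE of route `route-MatrixMultiplication-CondensationDistance`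
("ω ≤ ω(Det)", Bürgisser–Clausen–Shokrollahi 1997, Thm. (16.7), second half) in the tree's
currencies:

  `DerivationsBoundOmega : ∀ τ ≥ 2, (∃ C n₀, ∀ n ≥ n₀, ∃ m' (h : n ≤ m') s, s ≤ C·n^τ ∧
      Derivable ℂ s (entries of the generic n × m' matrix Z = [X | Y]) {det X}) → omega ℂ ≤ τ`.

Proof = line `birth` of the crux (`Cruxes/DerivationsBoundOmega/Lines/birth.lean`), the modern
route through the determinantal ideal; every stub is landed in its own Theorems file:

* `stub_pairsSimulation` (Strassen 1973, Vermeidung von Divisionen, pairs form): a derivation of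
  `det X` of length `s` over `ℂ(Z)` yields a nonzero `q ∈ ℂ[Z]` with `complexity (q · det X) ≤ 4s`
  (file `CondensationDistanceDerivationsBoundOmegaStubPairsSimulation.lean`, from the in-tree
  `Theorems.stub_pairs`);
* `stub_andrewsLeadingBlock` (Andrews 2022, Thm. 3 at `(ℂ, 4t, m', 4t)`): `q · det X` is a nonzero
  member of `I^det_{4t,m',4t}`, so `bR(⟨t,t,t⟩) ≤ 6 · complexity (q · det X)`
  (file `…StubAndrewsLeadingBlock.lean`, from `Andrews2022_thm3_holds`);
* `stub_borderRankExponent` (Bini 1980 / Bläser 2013 Thm. 6.6 in exponent form):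
  `bR(⟨q,q,q⟩) ≤ A q^τ` for all large `q` gives `omega ℂ ≤ τ`
  (file `…StubBorderRankExponent.lean`, from `Blaser2013_thm66_holds`);
* `DerivationsBoundOmega_of_stubs` — the glue (kernel-checked in the skeleton): given `τ ≥ 2` and
  `C, n₀`, feed stub 3 with `A := 24·|C|·4^τ`, `q₀ := n₀`; for `q ≥ n₀` take `n := 4q`, get `m', h, s`;
  stub 1 gives `q' ≠ 0` with `complexity ≤ 4s`; stub 2 gives `bR(⟨q,q,q⟩) ≤ 24 s ≤ 24·|C|·4^τ·q^τ`;
* `DerivationsBoundOmega_of : DerivationsBoundOmega` — the crux BY NAME.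

No auxiliary-column specialisation, no division-model Baur–Strassen and no BCS (7.1) are needed on
this route: the auxiliary columns `Y` are simply more variables of the ideal's ring.

## References
* [BurgisserClausenShokrollahi1997] P. Bürgisser, M. Clausen, M. A. Shokrollahi, Algebraic Complexity
  Theory (1997), Thm. (16.7), §7.1.
* [Strassen1973] V. Strassen, Vermeidung von Divisionen, J. reine angew. Math. 264 (1973), §2.
* [Andrews2022] R. Andrews, On Matrix Multiplication and Polynomial Identity Testing, FOCS 2022, Thm. 3.
* [Blaser2013] M. Bläser, Fast Matrix Multiplication, ToC Graduate Surveys 5 (2013), Thm. 6.6.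
-/

-- the tree's namespace `Summit.MatrixMultiplication.MatrixMultiplication.…` repeats a component by design
set_option linter.dupNamespace false

noncomputable section

namespace Summit.MatrixMultiplication.MatrixMultiplication.Theorems.DerivationsBoundOmega

open Literature.Computability.AlgebraicComplexity
open Summit.MatrixMultiplication.MatrixMultiplication.Theses.CondensationDistance (DerivationsBoundOmega)

/-- **Composition with explicit hypotheses: stub 1 → stub 2 → stub 3 → the crux statement**
(conclusion = the body of `DerivationsBoundOmega` verbatim). Given `τ ≥ 2` and the hypothesis'
`C, n₀`, apply stub 3 with `A := 24·|C|·4^τ`, `q₀ := n₀`: for `q ≥ n₀`, `n := 4q ≥ n₀` has a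
derivation of `det X` of length `s ≤ C·(4q)^τ`; stub 1 gives `q' ≠ 0` with `complexity (q'·det X) ≤ 4s`;
stub 2 gives `bR(⟨q,q,q⟩) ≤ 24 s ≤ 24·|C|·4^τ·q^τ`. (Verbatim from the registered skeleton
`Lines/birth.lean`.) [cite: Andrews2022, Thm. 3; Blaser2013, Thm. 6.6] -/
theorem DerivationsBoundOmega_of_stubs
    (h1 : ∀ (n m' : ℕ) (h : n ≤ m') (s : ℕ),
      Derivable ℂ s
        (Set.range fun p : Fin n × Fin m' =>
          algebraMap (MvPolynomial (Fin n × Fin m') ℂ) (FractionRing (MvPolynomial (Fin n × Fin m') ℂ))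
            (MvPolynomial.X p))
        {algebraMap (MvPolynomial (Fin n × Fin m') ℂ) (FractionRing (MvPolynomial (Fin n × Fin m') ℂ))
          (Matrix.det (Matrix.of fun i j : Fin n => MvPolynomial.X (i, Fin.castLE h j)))} →
      ∃ q : MvPolynomial (Fin n × Fin m') ℂ, q ≠ 0 ∧
        complexity (q * Matrix.det (Matrix.of fun i j : Fin n => MvPolynomial.X (i, Fin.castLE h j))) ≤
          4 * s)
    (h2 : ∀ (t m' : ℕ) (h : 4 * t ≤ m') (q : MvPolynomial (Fin (4 * t) × Fin m') ℂ), q ≠ 0 →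
      algBorderRank (matMulTensor ℂ t t t) ≤
        6 * complexity (q * Matrix.det (Matrix.of fun i j : Fin (4 * t) => MvPolynomial.X (i, Fin.castLE h j))))
    (h3 : ∀ τ : ℝ, (∃ A : ℝ, ∃ q₀ : ℕ, ∀ q ≥ q₀,
        (algBorderRank (matMulTensor ℂ q q q) : ℝ) ≤ A * (q : ℝ) ^ τ) →
      omega ℂ ≤ τ) :
    ∀ τ : ℝ, 2 ≤ τ →
      (∃ C : ℝ, ∃ n₀ : ℕ, ∀ n ≥ n₀, ∃ (m' : ℕ) (h : n ≤ m') (s : ℕ), (s : ℝ) ≤ C * (n : ℝ) ^ τ ∧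
        Derivable ℂ s
          (Set.range fun p : Fin n × Fin m' =>
            algebraMap (MvPolynomial (Fin n × Fin m') ℂ) (FractionRing (MvPolynomial (Fin n × Fin m') ℂ))
              (MvPolynomial.X p))
          {algebraMap (MvPolynomial (Fin n × Fin m') ℂ) (FractionRing (MvPolynomial (Fin n × Fin m') ℂ))
            (Matrix.det (Matrix.of fun i j : Fin n => MvPolynomial.X (i, Fin.castLE h j)))}) →
      omega ℂ ≤ τ := by
  intro τ _hτ hyp
  obtain ⟨C, n₀, hC⟩ := hyp
  refine h3 τ ⟨24 * |C| * (4 : ℝ) ^ τ, n₀, fun q hq => ?_⟩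
  -- the hypothesis at size `n = 4q ≥ n₀`
  obtain ⟨m', h, s, hs, hD⟩ := hC (4 * q) (by omega)
  -- stub 1: a nonzero multiple of `det X` of division-free complexity `≤ 4s`
  obtain ⟨q', hq', hcx⟩ := h1 (4 * q) m' h s hD
  -- stub 2: Andrews' lifting at `t = q`
  have hbr := h2 q m' h q' hq'
  have hbrs : algBorderRank (matMulTensor ℂ q q q) ≤ 24 * s := hbr.trans (by omega)
  -- real bookkeeping: `24 s ≤ 24 C (4q)^τ ≤ 24 |C| 4^τ q^τ`
  have hq0 : (0 : ℝ) ≤ (q : ℝ) := by positivity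
  have hpow : (0 : ℝ) ≤ (4 * (q : ℝ)) ^ τ := Real.rpow_nonneg (by positivity) _
  have hsR : (s : ℝ) ≤ |C| * (4 * (q : ℝ)) ^ τ := by
    have hs' : (s : ℝ) ≤ C * (4 * (q : ℝ)) ^ τ := by
      have := hs
      push_cast at this
      exact this
    exact hs'.trans (mul_le_mul_of_nonneg_right (le_abs_self C) hpow)
  have h4q : (4 * (q : ℝ)) ^ τ = (4 : ℝ) ^ τ * (q : ℝ) ^ τ := Real.mul_rpow (by norm_num) hq0
  calc (algBorderRank (matMulTensor ℂ q q q) : ℝ) ≤ ((24 * s : ℕ) : ℝ) := by exact_mod_cast hbrs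
    _ = 24 * (s : ℝ) := by push_cast; ring
    _ ≤ 24 * (|C| * (4 * (q : ℝ)) ^ τ) := by nlinarith [hsR]
    _ = 24 * |C| * (4 : ℝ) ^ τ * (q : ℝ) ^ τ := by rw [h4q]; ring

/-- **The crux `DerivationsBoundOmega` of route CondensationDistance** (BCS 1997 Thm. (16.7),
"ω ≤ ω(Det)", in the tree's currencies `Derivable` / `omega`): if `det X_n` is computable from the
entries of the generic `n × m'` matrix `[X | Y]` by straight-line programs with division of length
`≤ C·n^τ` for all large `n`, then `omega ℂ ≤ τ`. Proof: Strassen pairs (`stub_pairsSimulation`) →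
Andrews' lifting (`stub_andrewsLeadingBlock`) → Bini (`stub_borderRankExponent`), composed by
`DerivationsBoundOmega_of_stubs`. [cite: BurgisserClausenShokrollahi1997, Thm. (16.7); Andrews2022, Thm. 3] -/
theorem DerivationsBoundOmega_of : DerivationsBoundOmega :=
  DerivationsBoundOmega_of_stubs stub_pairsSimulation stub_andrewsLeadingBlock stub_borderRankExponent

end Summit.MatrixMultiplication.MatrixMultiplication.Theorems.DerivationsBoundOmega

end
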